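import Literature.NumberTheory.GaloisRepresentations.CharacterPeriodsAdmissible
import Literature.NumberTheory.GaloisRepresentations.LabelledWeightsDeRhamRank
import HarnessLib

/-!
# Evaluation of `(Fin 1 → E) ⊗_{ℚ_p} B` at a `ℚ_p`-embedding `j : E → F̄` (rank one, with coefficients)

Let `F/ℚ_p` be a field, `𝔅` a period-ring datum for `Γ_F = Gal(F̄/F)` over `ℚ_p` with invariants `F`,
receiving `F̄` through a ring map `ι : F̄ → B` (`Γ_F`-equivariant, extending `F → B`), and `E/ℚ_p` a
finite extension (the coefficient field).  For a `ℚ_p`-embedding `j : E → F̄` the **evaluation**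
`ev_j : (Fin 1 → E) ⊗_{ℚ_p} B → B`, `m ⊗ b ↦ ι(j(m 0)) · b`, is the `j`-component of
`E ⊗_{ℚ_p} B ≅ ∏_{j} B` (when `B ⊇ F̄` and `E/ℚ_p` is separable, Fontaine, Astérisque 223, Exp. III §1.5).
This file proves the bookkeeping used to read LABELLED Hodge–Tate weights of rank-one representations
with coefficients off a single period (file `LabelledWeightsRankOneThetaPeriod`):

* `evalEmb_smul`, `evalEmb_baseAct`: `ev_j (c • x) = ι(j c) ev_j x` (`c ∈ E`),
  `ev_j (f ·_B x) = f · ev_j x` (`f ∈ F`);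
* `evalEmb_eq_zero_of_mem_labelD`: on the `τ`-component `D_τ`, `ev_j = 0` unless `j` lies over `τ`;
* `evalEmb_absGalEmbComp`: for `x ∈ D(rE)`, `ev_{σ ∘ j} x = σ(ι(j(det rE σ)) · ev_j x)`;
* `coords_eq_sum_evalEmb` (inversion of the embeddings matrix, `disc(E/ℚ_p) ≠ 0`): every coordinate
  of `x` is an `ι(F̄)`-linear combination of the values `ev_{j'} x`; whence
  `eq_zero_of_forall_evalEmb_eq_zero` (the `ev_{j'}` are jointly injective) and
  `mem_coeffFilTensor_iff_forall_evalEmb_mem` (`x ∈ M ⊗ Fil^i ⟺ ev_{j'} x ∈ Fil^i` for all `j'`, when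
  `ι(F̄) ⊆ Fil^0`);
* `exists_absGalEmbComp_eq`: two embeddings over the same label `τ : F → E` differ by some `σ ∈ Γ_F`.

## References
* [FontaineAsterisque223III] J.-M. Fontaine, *Représentations p-adiques semi-stables*, Astérisque 223,
  Exp. III §1.5, Prop. 1.5.2.
* [SerreAbelianLadic1968] J.-P. Serre, *Abelian ℓ-adic representations*, Ch. III App. A.
* [Patrikis2019] S. Patrikis, *Variations on a theorem of Tate*, §2.3.1.
-/

noncomputable section

open Field Matrix TensorProduct
open scoped MatrixGroups TensorProduct

namespace Literature.NumberTheory.PAdicHodge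

open Literature.NumberTheory.GaloisRepresentations

namespace RankOneLabelledWeights

variable {F : Type} [Field F] {p : ℕ} [Fact p.Prime] [Algebra ℚ_[p] F]
  (𝔅 : PeriodRingData.{0, 0, 0, 0} (absoluteGaloisGroup F) ℚ_[p] F)
  (ι : AlgebraicClosure F →+* 𝔅.B)
  {E : Type} [Field E] [Algebra ℚ_[p] E]

-- Mathlib's own global value of `maxSynthPendingDepth` (see `PeriodRingData.rank_D_le`).
set_option maxSynthPendingDepth 3

/-- `algebraMap ℚ_p B` factors through `ι` as soon as `ι` extends `F → B`. [cite: FontaineAsterisque223III, Exp. III §1.5]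
-/
theorem algebraMap_padic_eq_iota
    (hιa : ∀ a : F, ι (algebraMap F (AlgebraicClosure F) a) = algebraMap F 𝔅.B a) (c : ℚ_[p]) :
    algebraMap ℚ_[p] 𝔅.B c = ι (algebraMap ℚ_[p] (AlgebraicClosure F) c) := by
  rw [PeriodRingData.algebraMap_eq, ← hιa, IsScalarTower.algebraMap_apply ℚ_[p] F (AlgebraicClosure F)]

/-! ### The evaluation map -/

/-- The `ℚ_p`-linear map `m ↦ ι(j(m 0))`, `(Fin 1 → E) → B`. [folklore] -/
def coordHom (j : E →ₐ[ℚ_[p]] AlgebraicClosure F)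
    (hιq : ∀ c : ℚ_[p], algebraMap ℚ_[p] 𝔅.B c = ι (algebraMap ℚ_[p] (AlgebraicClosure F) c)) :
    (Fin 1 → E) →ₗ[ℚ_[p]] 𝔅.B where
  toFun m := ι (j (m 0))
  map_add' m m' := by simp only [Pi.add_apply, map_add]
  map_smul' c m := by
    simp only [Pi.smul_apply, RingHom.id_apply, Algebra.smul_def, map_mul, AlgHom.commutes, hιq]

/-- **Evaluation at the embedding `j`**: `ev_j (m ⊗ b) = ι(j(m 0)) · b`.
[cite: FontaineAsterisque223III, Exp. III §1.5] -/
def evalEmb (j : E →ₐ[ℚ_[p]] AlgebraicClosure F)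
    (hιq : ∀ c : ℚ_[p], algebraMap ℚ_[p] 𝔅.B c = ι (algebraMap ℚ_[p] (AlgebraicClosure F) c)) :
    (Fin 1 → E) ⊗[ℚ_[p]] 𝔅.B →ₗ[ℚ_[p]] 𝔅.B :=
  TensorProduct.lift ((LinearMap.mul ℚ_[p] 𝔅.B).comp (coordHom 𝔅 ι j hιq))

variable (j : E →ₐ[ℚ_[p]] AlgebraicClosure F)
  (hιq : ∀ c : ℚ_[p], algebraMap ℚ_[p] 𝔅.B c = ι (algebraMap ℚ_[p] (AlgebraicClosure F) c))

/-- `ev_j` on pure tensors. [cite: FontaineAsterisque223III, Exp. III §1.5]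
-/
@[simp] theorem evalEmb_tmul (m : Fin 1 → E) (b : 𝔅.B) :
    evalEmb 𝔅 ι j hιq (m ⊗ₜ[ℚ_[p]] b) = ι (j (m 0)) * b := rfl

/-- `ev_j (c • x) = ι(j c) · ev_j x` for `c ∈ E` (the `E`-structure through the left factor).
[cite: FontaineAsterisque223III, Exp. III §1.5]
-/
theorem evalEmb_smul (c : E) (x : (Fin 1 → E) ⊗[ℚ_[p]] 𝔅.B) :
    evalEmb 𝔅 ι j hιq (c • x) = ι (j c) * evalEmb 𝔅 ι j hιq x := by
  induction x using TensorProduct.induction_on with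
  | zero => rw [smul_zero, map_zero, mul_zero]
  | tmul m b =>
    rw [TensorProduct.smul_tmul', evalEmb_tmul, evalEmb_tmul, Pi.smul_apply, smul_eq_mul, map_mul,
      map_mul, mul_assoc]
  | add x y hx hy => rw [smul_add, map_add, map_add, hx, hy, mul_add]

/-- `ev_j (baseAct f x) = f · ev_j x` for `f ∈ F` (the `F`-structure through the right factor).
[cite: FontaineAsterisque223III, Exp. III §1.5]
-/
theorem evalEmb_baseAct (f : F) (x : (Fin 1 → E) ⊗[ℚ_[p]] 𝔅.B) :
    evalEmb 𝔅 ι j hιq (𝔅.baseAct E (Fin 1 → E) f x) = algebraMap F 𝔅.B f * evalEmb 𝔅 ι j hιq x := by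
  induction x using TensorProduct.induction_on with
  | zero => rw [map_zero, map_zero, mul_zero]
  | tmul m b =>
    rw [PeriodRingData.baseAct_tmul, evalEmb_tmul, evalEmb_tmul, Algebra.smul_def, mul_left_comm]
  | add x y hx hy => rw [map_add, map_add, hx, hy, map_add, mul_add]

/-- **On the `τ`-component, `ev_j = 0` unless `j` lies over `τ`.**  If `x ∈ D_τ` and
`j(τ a) ≠ a` for some `a ∈ F`, then `ev_j x = 0` (`B` is a domain).
[cite: FontaineAsterisque223III, Exp. III §1.5] [cite: Patrikis2019, §2.3.1] -/
theorem evalEmb_eq_zero_of_mem_labelD [TopologicalSpace E] [IsTopologicalRing E]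
    (hιa : ∀ a : F, ι (algebraMap F (AlgebraicClosure F) a) = algebraMap F 𝔅.B a)
    (ρ : ContinuousRep (absoluteGaloisGroup F) E (Fin 1 → E))
    (τ : F →ₐ[ℚ_[p]] E) {x : (Fin 1 → E) ⊗[ℚ_[p]] 𝔅.B} (hx : x ∈ 𝔅.labelD ρ τ.toRingHom)
    (hj : ∃ a : F, j (τ a) ≠ algebraMap F (AlgebraicClosure F) a) :
    evalEmb 𝔅 ι j hιq x = 0 := by
  obtain ⟨a, ha⟩ := hj
  have h := congrArg (evalEmb 𝔅 ι j hιq) (hx.2 a)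
  rw [evalEmb_baseAct, evalEmb_smul, AlgHom.toRingHom_eq_coe, RingHom.coe_coe, ← hιa, ← sub_eq_zero,
    ← sub_mul, mul_eq_zero] at h
  rcases h with h | h
  · exact absurd (ι.injective (sub_eq_zero.mp h)).symm ha
  · exact h

/-- A rank-one framed representation acts on `Fin 1 → E` through its determinant. [cite: FontaineAsterisque223III, Exp. III §1.5]
-/
theorem toContinuousRep_apply_eq_det_smul [TopologicalSpace E] [IsTopologicalRing E] (rE : FramedRep (absoluteGaloisGroup F) E 1)
    (σ : absoluteGaloisGroup F) (m : Fin 1 → E) :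
    FramedRep.toContinuousRep rE σ m = ((FramedRep.det rE σ : Eˣ) : E) • m := by
  funext i
  rw [FramedRep.toContinuousRep_apply_apply, Pi.smul_apply, smul_eq_mul, FramedRep.det_apply,
    Matrix.GeneralLinearGroup.val_det_apply, Matrix.det_fin_one, Matrix.mulVec, dotProduct,
    Fin.sum_univ_one, Subsingleton.elim i 0]

/-- **`ev_{σ ∘ j}` on the invariants.**  For `x ∈ D(rE) = ((Fin 1 → E) ⊗ B)^{Γ_F}` (rank one),
`ev_{σ ∘ j} x = σ • (ι(j(det rE σ)) · ev_j x)`. [cite: FontaineAsterisque223III, Exp. III §1.5] -/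
theorem evalEmb_absGalEmbComp [TopologicalSpace E] [IsTopologicalRing E]
    (hισ : ∀ (σ : absoluteGaloisGroup F) (x : AlgebraicClosure F), σ • ι x = ι (σ • x))
    (rE : FramedRep (absoluteGaloisGroup F) E 1)
    {x : (Fin 1 → E) ⊗[ℚ_[p]] 𝔅.B} (hx : x ∈ 𝔅.coeffD (FramedRep.toContinuousRep rE))
    (σ : absoluteGaloisGroup F) :
    evalEmb 𝔅 ι (absGalEmbComp σ j) hιq x =
      σ • (ι (j ((FramedRep.det rE σ : Eˣ) : E)) * evalEmb 𝔅 ι j hιq x) := by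
  have key : ∀ y : (Fin 1 → E) ⊗[ℚ_[p]] 𝔅.B,
      evalEmb 𝔅 ι (absGalEmbComp σ j) hιq (𝔅.coeffTensorRep (FramedRep.toContinuousRep rE) σ y) =
        σ • (ι (j ((FramedRep.det rE σ : Eˣ) : E)) * evalEmb 𝔅 ι j hιq y) := by
    intro y
    induction y using TensorProduct.induction_on with
    | zero => rw [map_zero, map_zero, map_zero, mul_zero, smul_zero]
    | tmul m b =>
      rw [PeriodRingData.coeffTensorRep_apply_tmul, evalEmb_tmul, evalEmb_tmul,
        toContinuousRep_apply_eq_det_smul, Pi.smul_apply, smul_eq_mul, absGalEmbComp_apply, map_mul j,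
        smul_mul' σ (j _) (j _), map_mul ι, smul_mul' σ, smul_mul' σ, hισ, hισ, mul_assoc]
    | add y z hy hz => rw [map_add, map_add, hy, hz, map_add, mul_add, smul_add]
  have h := key x
  rwa [(PeriodRingData.mem_coeffD_iff 𝔅 _ x).mp hx σ] at h

/-! ### Coordinates and the embeddings matrix -/

/-- Coordinates of `(Fin 1 → E) ⊗_{ℚ_p} B` in a `ℚ_p`-basis `b` of `Fin 1 → E`. [folklore] -/
def coords {κ : Type} [DecidableEq κ] (b : Module.Basis κ ℚ_[p] (Fin 1 → E)) :
    (Fin 1 → E) ⊗[ℚ_[p]] 𝔅.B ≃ₗ[ℚ_[p]] (κ →₀ 𝔅.B) :=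
  TensorProduct.congr b.repr (LinearEquiv.refl ℚ_[p] 𝔅.B) ≪≫ₗ finsuppScalarLeft ℚ_[p] 𝔅.B κ

/-- Coordinates of a pure tensor. [cite: FontaineAsterisque223III, Exp. III §1.5]
-/
theorem coords_tmul {κ : Type} [DecidableEq κ] (b : Module.Basis κ ℚ_[p] (Fin 1 → E)) (m : Fin 1 → E) (x : 𝔅.B)
    (k : κ) : coords 𝔅 b (m ⊗ₜ[ℚ_[p]] x) k = b.repr m k • x := by
  simp only [coords, LinearEquiv.trans_apply, TensorProduct.congr_tmul, LinearEquiv.refl_apply,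
    finsuppScalarLeft_apply_tmul_apply]

/-- The inverse coordinate map on one coordinate. [cite: FontaineAsterisque223III, Exp. III §1.5]
-/
theorem coords_symm_single {κ : Type} [DecidableEq κ] (b : Module.Basis κ ℚ_[p] (Fin 1 → E)) (k : κ) (x : 𝔅.B) :
    (coords 𝔅 b).symm (Finsupp.single k x) = b k ⊗ₜ[ℚ_[p]] x := by
  rw [coords, LinearEquiv.trans_symm, LinearEquiv.trans_apply, finsuppScalarLeft_symm_apply_single,
    TensorProduct.congr_symm_tmul, LinearEquiv.refl_symm, LinearEquiv.refl_apply,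
    Module.Basis.repr_symm_single_one]

/-- Expansion in coordinates: `x = Σ_k b_k ⊗ x_k`. [cite: FontaineAsterisque223III, Exp. III §1.5]
-/
theorem eq_sum_coords {κ : Type} [Fintype κ] [DecidableEq κ] (b : Module.Basis κ ℚ_[p] (Fin 1 → E))
    (x : (Fin 1 → E) ⊗[ℚ_[p]] 𝔅.B) : x = ∑ k, b k ⊗ₜ[ℚ_[p]] coords 𝔅 b x k := by
  have hx : x = (coords 𝔅 b).symm (coords 𝔅 b x) := ((coords 𝔅 b).symm_apply_apply x).symm
  conv_lhs => rw [hx, ← Finsupp.sum_single (coords 𝔅 b x), Finsupp.sum, map_sum]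
  simp only [coords_symm_single]
  exact Finset.sum_subset (Finset.subset_univ _) fun k _ hk => by
    rw [Finsupp.notMem_support_iff.mp hk, TensorProduct.tmul_zero]

/-- `ev_j x = Σ_k ι(j(b_k 0)) · x_k`. [cite: FontaineAsterisque223III, Exp. III §1.5]
-/
theorem evalEmb_eq_sum_coords {κ : Type} [Fintype κ] [DecidableEq κ] (b : Module.Basis κ ℚ_[p] (Fin 1 → E))
    (x : (Fin 1 → E) ⊗[ℚ_[p]] 𝔅.B) :
    evalEmb 𝔅 ι j hιq x = ∑ k, ι (j (b k 0)) * coords 𝔅 b x k := by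
  conv_lhs => rw [eq_sum_coords 𝔅 b x]
  simp only [map_sum, evalEmb_tmul]

/-- The coordinates of an element of `M ⊗ Fil^i` lie in `Fil^i`. [cite: FontaineAsterisque223III, Exp. III §1.5]
-/
theorem coords_mem_fil_of_mem_coeffFilTensor {κ : Type} [DecidableEq κ] (b : Module.Basis κ ℚ_[p] (Fin 1 → E))
    (i : ℤ) {x : (Fin 1 → E) ⊗[ℚ_[p]] 𝔅.B} (hx : x ∈ 𝔅.coeffFilTensor E (Fin 1 → E) i) (k : κ) :
    coords 𝔅 b x k ∈ 𝔅.fil i := by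
  obtain ⟨y, rfl⟩ := hx
  induction y using TensorProduct.induction_on with
  | zero => rw [map_zero, map_zero, Finsupp.zero_apply]; exact zero_mem _
  | tmul m c =>
    rw [TensorProduct.AlgebraTensorModule.map_tmul, LinearMap.id_apply, Submodule.subtype_apply,
      coords_tmul]
    exact Submodule.smul_of_tower_mem _ _ c.2
  | add y z hy hz => rw [map_add, map_add, Finsupp.add_apply]; exact add_mem hy hz

/-- A tensor all of whose coordinates lie in `Fil^i` lies in `M ⊗ Fil^i`. [cite: FontaineAsterisque223III, Exp. III §1.5]
-/
theorem mem_coeffFilTensor_of_forall_coords_mem {κ : Type} [Fintype κ] [DecidableEq κ]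
    (b : Module.Basis κ ℚ_[p] (Fin 1 → E)) (i : ℤ) (x : (Fin 1 → E) ⊗[ℚ_[p]] 𝔅.B)
    (h : ∀ k, coords 𝔅 b x k ∈ 𝔅.fil i) : x ∈ 𝔅.coeffFilTensor E (Fin 1 → E) i := by
  rw [eq_sum_coords 𝔅 b x]
  refine Submodule.sum_mem _ fun k _ => ?_
  exact ⟨b k ⊗ₜ ⟨coords 𝔅 b x k, h k⟩, rfl⟩

/-- **Inversion of the embeddings matrix.**  There are a `ℚ_p`-basis `b` of `Fin 1 → E`, an
enumeration `ε` of the `ℚ_p`-embeddings `E → F̄` and a matrix `N` over `F̄` with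
`x_k = Σ_i ι(N_{k i}) · ev_{ε i} x` for every `x` and `k` (`N` is the inverse of the embeddings matrix
`(ε_i(b_k 0))`, invertible because `disc(E/ℚ_p) ≠ 0`).
[cite: FontaineAsterisque223III, Exp. III Prop. 1.5.2] -/
theorem exists_coords_eq_sum_evalEmb [FiniteDimensional ℚ_[p] E] :
    ∃ (m : ℕ) (b : Module.Basis (Fin m) ℚ_[p] (Fin 1 → E))
      (ε : Fin m ≃ (E →ₐ[ℚ_[p]] AlgebraicClosure F)) (N : Matrix (Fin m) (Fin m) (AlgebraicClosure F)),
      ∀ (x : (Fin 1 → E) ⊗[ℚ_[p]] 𝔅.B) (k : Fin m),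
        coords 𝔅 b x k = ∑ i, ι (N k i) * evalEmb 𝔅 ι (ε i) hιq x := by
  classical
  obtain ⟨m, hm⟩ : ∃ m, m = Module.finrank ℚ_[p] E := ⟨_, rfl⟩
  let e : Module.Basis (Fin m) ℚ_[p] E := Module.finBasisOfFinrankEq ℚ_[p] E hm.symm
  haveI : Algebra.IsSeparable ℚ_[p] E := Algebra.IsSeparable.of_integral ℚ_[p] E
  have hcard : Fintype.card (Fin m) = Fintype.card (E →ₐ[ℚ_[p]] AlgebraicClosure F) := by
    rw [Fintype.card_fin, AlgHom.card, hm]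
  let ε : Fin m ≃ (E →ₐ[ℚ_[p]] AlgebraicClosure F) := Fintype.equivOfCardEq hcard
  let b : Module.Basis (Fin m) ℚ_[p] (Fin 1 → E) := e.map (LinearEquiv.funUnique (Fin 1) ℚ_[p] E).symm
  have hb : ∀ k, b k 0 = e k := fun k => by
    simp only [b, Module.Basis.map_apply]
    rfl
  -- the embeddings matrix and its inverse
  let M : Matrix (Fin m) (Fin m) (AlgebraicClosure F) :=
    Algebra.embeddingsMatrixReindex ℚ_[p] (AlgebraicClosure F) e ε
  have hMdet : M.det ≠ 0 := by
    intro h0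
    have h := Algebra.discr_eq_det_embeddingsMatrixReindex_pow_two ℚ_[p] (AlgebraicClosure F) e ε
    rw [show Algebra.embeddingsMatrixReindex ℚ_[p] (AlgebraicClosure F) (⇑e) ε = M from rfl, h0,
      zero_pow two_ne_zero, map_eq_zero] at h
    exact Algebra.discr_not_zero_of_basis ℚ_[p] e h
  have hMTdet : IsUnit Mᵀ.det := by rw [Matrix.det_transpose]; exact isUnit_iff_ne_zero.mpr hMdet
  let A : Matrix (Fin m) (Fin m) 𝔅.B := ι.mapMatrix Mᵀ
  have hA : ∀ i k, A i k = ι (ε i (e k)) := fun i k => rfl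
  have hNA : ι.mapMatrix Mᵀ⁻¹ * A = 1 := by
    rw [← map_mul, Matrix.nonsing_inv_mul _ hMTdet, map_one]
  refine ⟨m, b, ε, Mᵀ⁻¹, fun x k => ?_⟩
  -- `ev_{ε i} x = (A c)_i`
  have hev : ∀ i, evalEmb 𝔅 ι (ε i) hιq x = (A *ᵥ fun k => coords 𝔅 b x k) i := by
    intro i
    rw [evalEmb_eq_sum_coords 𝔅 ι (ε i) hιq b x, Matrix.mulVec, dotProduct]
    simp only [hA, hb]
  have hc : (fun k => coords 𝔅 b x k) =
      ι.mapMatrix Mᵀ⁻¹ *ᵥ (A *ᵥ fun k => coords 𝔅 b x k) := by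
    rw [Matrix.mulVec_mulVec, hNA, Matrix.one_mulVec]
  have hk : coords 𝔅 b x k = (ι.mapMatrix Mᵀ⁻¹ *ᵥ (A *ᵥ fun k => coords 𝔅 b x k)) k := by
    rw [← hc]
  rw [hk, Matrix.mulVec, dotProduct]
  refine Finset.sum_congr rfl fun i _ => ?_
  rw [RingHom.mapMatrix_apply, Matrix.map_apply, hev]

/-- **The evaluations are jointly injective**: if `ev_{j'} x = 0` for every `ℚ_p`-embedding
`j' : E → F̄`, then `x = 0`. [cite: FontaineAsterisque223III, Exp. III Prop. 1.5.2] -/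
theorem eq_zero_of_forall_evalEmb_eq_zero [FiniteDimensional ℚ_[p] E] (x : (Fin 1 → E) ⊗[ℚ_[p]] 𝔅.B)
    (hx : ∀ j' : E →ₐ[ℚ_[p]] AlgebraicClosure F, evalEmb 𝔅 ι j' hιq x = 0) : x = 0 := by
  obtain ⟨m, b, ε, N, hN⟩ := exists_coords_eq_sum_evalEmb 𝔅 ι hιq (E := E)
  rw [eq_sum_coords 𝔅 b x]
  refine Finset.sum_eq_zero fun k _ => ?_
  rw [hN x k]
  simp only [hx, mul_zero, Finset.sum_const_zero, TensorProduct.tmul_zero]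

/-- **The filtration read at the embeddings**: when `ι(F̄) ⊆ Fil^0 B`,
`x ∈ M ⊗ Fil^i B ⟺ ev_{j'} x ∈ Fil^i B` for every `ℚ_p`-embedding `j'`.
[cite: FontaineAsterisque223III, Exp. III §1.5.4 and Prop. 1.5.2] -/
theorem mem_coeffFilTensor_iff_forall_evalEmb_mem [FiniteDimensional ℚ_[p] E] (hιfil : ∀ y : AlgebraicClosure F, ι y ∈ 𝔅.fil 0)
    (i : ℤ) (x : (Fin 1 → E) ⊗[ℚ_[p]] 𝔅.B) :
    x ∈ 𝔅.coeffFilTensor E (Fin 1 → E) i ↔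
      ∀ j' : E →ₐ[ℚ_[p]] AlgebraicClosure F, evalEmb 𝔅 ι j' hιq x ∈ 𝔅.fil i := by
  obtain ⟨m, b, ε, N, hN⟩ := exists_coords_eq_sum_evalEmb 𝔅 ι hιq (E := E)
  constructor
  · intro hx j'
    rw [evalEmb_eq_sum_coords 𝔅 ι j' hιq b x]
    refine Submodule.sum_mem _ fun k _ => ?_
    have h := 𝔅.mul_mem_fil 0 i _ _ (hιfil (j' (b k 0))) (coords_mem_fil_of_mem_coeffFilTensor 𝔅 b i hx k)
    rwa [zero_add] at h
  · intro h
    refine mem_coeffFilTensor_of_forall_coords_mem 𝔅 b i x fun k => ?_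
    rw [hN x k]
    refine Submodule.sum_mem _ fun i' _ => ?_
    have h' := 𝔅.mul_mem_fil 0 i _ _ (hιfil (N k i')) (h (ε i'))
    rwa [zero_add] at h'

/-! ### Embeddings over a label form one `Γ_F`-orbit -/

/-- **Two `ℚ_p`-embeddings `E → F̄` over the same label `τ : F → E` differ by an element of `Γ_F`**
(extension of `F`-embeddings to the normal extension `F̄/F`).
[cite: MilneFT2022, Ch. 3 (extension of F-homomorphisms to a normal extension)] -/
theorem exists_absGalEmbComp_eq [FiniteDimensional ℚ_[p] E] (τ : F →ₐ[ℚ_[p]] E)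
    (j j' : E →ₐ[ℚ_[p]] AlgebraicClosure F)
    (hj : ∀ a : F, j (τ a) = algebraMap F (AlgebraicClosure F) a)
    (hj' : ∀ a : F, j' (τ a) = algebraMap F (AlgebraicClosure F) a) :
    ∃ σ : absoluteGaloisGroup F, absGalEmbComp σ j = j' := by
  letI : Algebra F E := τ.toRingHom.toAlgebra
  haveI : IsScalarTower ℚ_[p] F E := IsScalarTower.of_algebraMap_eq fun c => (τ.commutes c).symm
  haveI : Module.Finite F E := Module.Finite.of_restrictScalars_finite ℚ_[p] F E
  haveI : Algebra.IsAlgebraic F E := Algebra.IsAlgebraic.of_finite F E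
  -- `j`, `j'` as `F`-algebra maps
  let jF : E →ₐ[F] AlgebraicClosure F := { j.toRingHom with commutes' := fun a => hj a }
  let jF' : E →ₐ[F] AlgebraicClosure F := { j'.toRingHom with commutes' := fun a => hj' a }
  -- the `F`-isomorphism `j(E) ≅ E ≅ j'(E)` extends to `F̄`
  let K : IntermediateField F (AlgebraicClosure F) := jF.fieldRange
  let eK : E ≃ₐ[F] K := AlgEquiv.ofInjectiveField jF
  let φ : K →ₐ[F] AlgebraicClosure F := jF'.comp eK.symm.toAlgHom
  let Φ : AlgebraicClosure F →ₐ[F] AlgebraicClosure F := φ.liftNormal (AlgebraicClosure F)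
  have hΦ : ∀ x : E, Φ (j x) = j' x := by
    intro x
    have h1 : (j x : AlgebraicClosure F) = algebraMap K (AlgebraicClosure F) (eK x) := rfl
    rw [h1, AlgHom.liftNormal_commutes]
    change jF' (eK.symm (eK x)) = j' x
    rw [AlgEquiv.symm_apply_apply]
    rfl
  let Φe : AlgebraicClosure F ≃ₐ[F] AlgebraicClosure F :=
    AlgEquiv.ofBijective Φ (Algebra.IsAlgebraic.algHom_bijective Φ)
  refine ⟨(absoluteGaloisGroup.toAlgEquiv F).symm Φe, ?_⟩
  ext x
  rw [absGalEmbComp_apply]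
  exact hΦ x

end RankOneLabelledWeights

end Literature.NumberTheory.PAdicHodge
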